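import Mathlib.Algebra.BigOperators.Field
import Mathlib.LinearAlgebra.Pi
import Mathlib.LinearAlgebra.Span.Basic
import Mathlib.Data.Rat.Cast.CharZero
import Mathlib.Algebra.Order.BigOperators.Ring.Finset
import HarnessLib

/-!
# Route `RamifiedHeegnerPair`, crux U₁ `LeafRankOneUpperAtThree` (stmt-BirchSwinnertonDyer-26022), line `partnerdescent` —
# partner kernel: every integral functional on the degree-zero lattice is a DUAL VECTOR for a positive diagonal pairing (input of `hEis`)

HONEST FRAMING. Theorems only; helper file (`--supports stmt-BirchSwinnertonDyer-26022 --as helper`); elementary linear algebra over `ℚ`; no number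
theory, no named fact, no `sorry`; nothing booked; BSD is proved for no curve. Lead prover bsd-line-rhp-p2 g63, 2026-08-31. Serves layer (α) of
LEAD-G63-ASSEMBLY.md §4c: the exact-Eisenstein hypothesis `hEis` of `LeafPartnerOrders.dvd_of_localRun` (p811638) needs, for each member `ψ` of a
`ℤ`-basis of functionals of `B = ℤ[Cls O]⁰`, a dual vector `x ∈ B^∨` (`x : Cls → ℚ`, degree `0`, `⟨x, b⟩ = ψ(b) ∈ ℤ` for `b ∈ B`) — exactly the
hypotheses `hdeg`, `hdual` of the landed `LeafPartnerBrandt.exact_eisenstein` (p806900), which then returns `(T_ℓ − ℓ − 1)·x ∈ B`.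

* `exists_degreeZero_dualVector` — for positive weights `w : ι → ℕ` and ANY `ℤ`-functional `ψ` of `ℤ^ι` there is `x : ι → ℚ` of degree zero with
  `Σ_c w_c x_c b_c = ψ(b)` for every `b` of degree zero: `x_c = (λ_c − κ)/w_c`, `λ_c = ψ(e_c)`, `κ = (Σ λ_c/w_c)/(Σ 1/w_c)`.
* `exists_extension_of_degreeZero` — every `ℤ`-functional of the degree-zero lattice extends to `ℤ^ι` (project along `e_{c₀}`).

[cite: Gross1987, §1 (the pairing `⟨e_i, e_j⟩ = w_i δ_ij` on `ℤ[Cls]`, its dual lattice)] [cite: BourbakiAlgebraI1989, Ch. II §2 no. 6]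
-/

set_option linter.dupNamespace false
set_option autoImplicit false

namespace Summit.BirchSwinnertonDyer.BirchSwinnertonDyer.Theorems.LeafPartnerBrandt

open Finset

variable {ι : Type*} [Fintype ι] [DecidableEq ι]

/-- **Dual vectors of degree zero.** For positive weights `w` and a `ℤ`-linear functional `ψ` on `ℤ^ι`, there is a rational vector `x` of
degree zero (`Σ x_c = 0`) whose Gross pairing with every integral vector `b` of degree zero is `ψ(b)`: with `λ_c := ψ(e_c)`,
`κ := (Σ_c λ_c/w_c)/(Σ_c 1/w_c)`, `x_c := (λ_c − κ)/w_c` one has `Σ_c w_c x_c b_c = Σ_c λ_c b_c − κ Σ_c b_c = ψ(b)`. So every functional of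
`B = ℤ[Cls]⁰` is represented by an element of `B^∨ ⊂ ℚ[Cls]⁰` — the input `hdual`/`hdeg` of `exact_eisenstein`. [cite: Gross1987, §1] -/
theorem exists_degreeZero_dualVector (w : ι → ℕ) (hw : ∀ c, 0 < w c) [Nonempty ι] (ψ : (ι → ℤ) →ₗ[ℤ] ℤ) :
    ∃ x : ι → ℚ, ∑ c, x c = 0 ∧
      ∀ b : ι → ℤ, ∑ c, b c = 0 → ∑ c, (w c : ℚ) * x c * (b c : ℚ) = (ψ b : ℚ) := by
  classical
  -- `λ_c = ψ(e_c)`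
  let lam : ι → ℚ := fun c ↦ (ψ (Pi.single c 1) : ℚ)
  have hwq : ∀ c, (w c : ℚ) ≠ 0 := fun c ↦ by exact_mod_cast (hw c).ne'
  have hSpos : 0 < ∑ c, (1 : ℚ) / w c :=
    Finset.sum_pos (fun c _ ↦ one_div_pos.mpr (by exact_mod_cast hw c)) Finset.univ_nonempty
  let κ : ℚ := (∑ c, lam c / w c) / ∑ c, (1 : ℚ) / w c
  refine ⟨fun c ↦ (lam c - κ) / w c, ?_, ?_⟩
  · -- degree zero by the choice of `κ`
    have h1 : ∑ c, (lam c - κ) / (w c : ℚ) = ∑ c, lam c / w c - κ * ∑ c, (1 : ℚ) / w c := by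
      rw [Finset.mul_sum, ← Finset.sum_sub_distrib]
      refine Finset.sum_congr rfl fun c _ ↦ ?_
      rw [sub_div, mul_one_div]
    rw [h1]
    have h2 : κ * ∑ c, (1 : ℚ) / w c = ∑ c, lam c / w c := div_mul_cancel₀ _ hSpos.ne'
    rw [h2, sub_self]
  · intro b hb
    -- `ψ b = Σ λ_c b_c`
    have hψ : (ψ b : ℚ) = ∑ c, lam c * (b c : ℚ) := by
      have hb' : b = ∑ c, b c • (Pi.single c 1 : ι → ℤ) := by
        ext i
        simp [Finset.sum_apply, Pi.single_apply]
      conv_lhs => rw [hb', map_sum]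
      push_cast
      refine Finset.sum_congr rfl fun c _ ↦ ?_
      simp only [map_zsmul, smul_eq_mul, Int.cast_mul, lam]
      ring
    rw [hψ]
    have hb0 : ∑ c, (b c : ℚ) = 0 := by exact_mod_cast hb
    calc ∑ c, (w c : ℚ) * ((lam c - κ) / w c) * (b c : ℚ)
        = ∑ c, (lam c * (b c : ℚ) - κ * (b c : ℚ)) := by
          refine Finset.sum_congr rfl fun c _ ↦ ?_
          rw [mul_div_cancel₀ _ (hwq c), sub_mul]
      _ = ∑ c, lam c * (b c : ℚ) - κ * ∑ c, (b c : ℚ) := by rw [Finset.sum_sub_distrib, Finset.mul_sum]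
      _ = ∑ c, lam c * (b c : ℚ) := by rw [hb0, mul_zero, sub_zero]

/-- **Functionals of the degree-zero lattice extend to `ℤ^ι`** (project along a coordinate vector: `v ↦ v − (Σ v)·e_{c₀}` is a `ℤ`-linear
retraction onto the degree-zero lattice). With `exists_degreeZero_dualVector`: every `ℤ`-functional of `B = ℤ[Cls]⁰` is `⟨x, ·⟩` for some
`x ∈ B^∨`. [cite: BourbakiAlgebraI1989, Ch. II §1 no. 9 (supplementary submodules)] -/
theorem exists_extension_of_degreeZero (c₀ : ι)
    (ψ : LinearMap.ker (LinearMap.lsum ℤ (fun _ : ι ↦ ℤ) ℤ fun _ ↦ LinearMap.id) →ₗ[ℤ] ℤ) :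
    ∃ Ψ : (ι → ℤ) →ₗ[ℤ] ℤ, ∀ b (hb : b ∈ LinearMap.ker (LinearMap.lsum ℤ (fun _ : ι ↦ ℤ) ℤ fun _ ↦ LinearMap.id)), Ψ b = ψ ⟨b, hb⟩ := by
  classical
  let σ : (ι → ℤ) →ₗ[ℤ] ℤ := LinearMap.lsum ℤ (fun _ : ι ↦ ℤ) ℤ fun _ ↦ LinearMap.id
  have hσ : ∀ v : ι → ℤ, σ v = ∑ c, v c := fun v ↦ by simp [σ, LinearMap.lsum_apply]
  -- the retraction `π v = v − (σ v) • e_{c₀}`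
  let π₀ : (ι → ℤ) →ₗ[ℤ] (ι → ℤ) := LinearMap.id - LinearMap.toSpanSingleton ℤ (ι → ℤ) (Pi.single c₀ 1) ∘ₗ σ
  have hπ₀ : ∀ v, π₀ v = v - σ v • Pi.single c₀ 1 := fun v ↦ by
    simp [π₀, LinearMap.toSpanSingleton_apply]
  have hmem : ∀ v, π₀ v ∈ LinearMap.ker σ := by
    intro v
    rw [LinearMap.mem_ker, hπ₀, map_sub, map_smul, hσ (Pi.single c₀ 1)]
    simp
  let π : (ι → ℤ) →ₗ[ℤ] LinearMap.ker σ := LinearMap.codRestrict _ π₀ hmem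
  refine ⟨ψ ∘ₗ π, fun b hb ↦ ?_⟩
  rw [LinearMap.comp_apply]
  congr 1
  apply Subtype.ext
  change π₀ b = b
  rw [hπ₀, LinearMap.mem_ker.mp hb, zero_smul, sub_zero]

end Summit.BirchSwinnertonDyer.BirchSwinnertonDyer.Theorems.LeafPartnerBrandt
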